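import Summits.Parity.GeneralizedHardyLittlewood.Theses.LiouvilleMAD

/-!
# `DivisorSwitch`: the δ-method as an exact finite identity (route `LiouvilleMAD`)

Item stmt-Parity-13320 (`Summit.Parity.GeneralizedHardyLittlewood.Theses.LiouvilleMAD.DivisorSwitch`,
support, = retired stmt-Parity-8053 verbatim): for every `f : ℕ → ℕ → ℝ` and all `M Q : ℕ`,
with `J = [Q, 2Q)` and pairs `(m, m′) ∈ (M, 2M]²`,

  `|J| · ∑_m f(m,m) + ∑_{0 < |k| ≤ M} ∑_{j ∈ J} ∑_{m − m′ = k j} f(m,m′) = ∑_{j ∈ J} ∑_{m ≡ m′ (mod j)} f(m,m′)`.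

This is the sharp-cutoff combinatorial skeleton of Duke–Friedlander–Iwaniec divisor switching
(Invent. Math. 115 (1994), §2; Heath-Brown, Crelle 481 (1996), Thm 1, and Iwaniec–Kowalski §20.5 give
the smooth δ-symbol form). No analysis is involved: for each modulus `j ∈ J` (so `j ≥ 1`) the
congruence class relation `m ≡ m′ (mod j)` on the box is split according to the integer
`k = (m − m′)/j ∈ [−M, M]` (`sum_filter_modEq_eq_diag_add_sum_lines`); the fibre `k = 0` is the
diagonal, and summing over `j` and exchanging the `j`- and `k`-sums gives the identity
(`DivisorSwitch_proof`). `Q = 0` (empty `J`) and `M = 0` (empty box) are degenerate but true cases of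
the same computation.
-/

open Finset

namespace Summit.Parity.GeneralizedHardyLittlewood.Theorems

/-- Fibre decomposition of one congruence class relation on the box `(M, 2M]²`: for `j ≥ 1`,
`∑_{m ≡ m′ (mod j)} f(m,m′) = ∑_m f(m,m) + ∑_{0 < |k| ≤ M} ∑_{m − m′ = k j} f(m,m′)`
(all pairs in `(M, 2M]²`). The class of `(m, m′)` is indexed by `k = (m − m′)/j`, and
`|k| ≤ |m − m′| < M`; the fibre `k = 0` is the diagonal. -/
theorem sum_filter_modEq_eq_diag_add_sum_lines (f : ℕ → ℕ → ℝ) (M : ℕ) {j : ℕ} (hj : 1 ≤ j) :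
    ∑ p ∈ (Ioc M (2 * M) ×ˢ Ioc M (2 * M)).filter (fun p : ℕ × ℕ => p.1 ≡ p.2 [MOD j]), f p.1 p.2
      = (∑ m ∈ Ioc M (2 * M), f m m)
        + ∑ k ∈ (Icc (-(M : ℤ)) M).erase 0,
            ∑ p ∈ (Ioc M (2 * M) ×ˢ Ioc M (2 * M)).filter
              (fun p : ℕ × ℕ => (p.1 : ℤ) - p.2 = k * (j : ℤ)), f p.1 p.2 := by
  have hj0 : (j : ℤ) ≠ 0 := by exact_mod_cast (show j ≠ 0 by omega)
  have hjpos : (0 : ℤ) < j := by exact_mod_cast hj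
  have hj1 : (1 : ℤ) ≤ j := by exact_mod_cast hj
  have hM0 : (0 : ℤ) ≤ M := Nat.cast_nonneg M
  have hMj : (M : ℤ) ≤ M * j := le_mul_of_one_le_right hM0 hj1
  -- every difference on the box lies in `[-M, M]`
  have hbound : ∀ p ∈ Ioc M (2 * M) ×ˢ Ioc M (2 * M),
      -(M : ℤ) ≤ (p.1 : ℤ) - p.2 ∧ (p.1 : ℤ) - p.2 ≤ M := by
    intro p hp
    rw [Finset.mem_product, Finset.mem_Ioc, Finset.mem_Ioc] at hp
    omega
  -- the fibre index `k = (m - m′)/j` lands in `[-M, M]`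
  have hmaps : ∀ p ∈ (Ioc M (2 * M) ×ˢ Ioc M (2 * M)).filter (fun p : ℕ × ℕ => p.1 ≡ p.2 [MOD j]),
      ((p.1 : ℤ) - p.2) / j ∈ Icc (-(M : ℤ)) M := by
    intro p hp
    rw [Finset.mem_filter] at hp
    obtain ⟨h1, h2⟩ := hbound p hp.1
    rw [Finset.mem_Icc]
    constructor
    · apply Int.le_ediv_of_mul_le hjpos
      nlinarith
    · apply Int.ediv_le_of_le_mul hjpos
      linarith
  rw [← Finset.sum_fiberwise_of_maps_to hmaps]
  -- the fibres are the lines `m - m′ = k j`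
  have hfib : ∀ k : ℤ,
      ((Ioc M (2 * M) ×ˢ Ioc M (2 * M)).filter (fun p : ℕ × ℕ => p.1 ≡ p.2 [MOD j])).filter
          (fun p : ℕ × ℕ => ((p.1 : ℤ) - p.2) / j = k)
        = (Ioc M (2 * M) ×ˢ Ioc M (2 * M)).filter
            (fun p : ℕ × ℕ => (p.1 : ℤ) - p.2 = k * (j : ℤ)) := by
    intro k
    rw [Finset.filter_filter]
    apply Finset.filter_congr
    intro p _
    constructor
    · rintro ⟨hmod, hdiv⟩
      have hd : (j : ℤ) ∣ (p.1 : ℤ) - p.2 := dvd_sub_comm.1 (Nat.modEq_iff_dvd.1 hmod)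
      rw [← hdiv, Int.ediv_mul_cancel hd]
    · intro hk
      refine ⟨?_, ?_⟩
      · refine Nat.modEq_iff_dvd.2 (dvd_sub_comm.1 ?_)
        rw [hk]
        exact dvd_mul_left _ _
      · rw [hk, Int.mul_ediv_cancel k hj0]
  simp only [hfib]
  rw [← Finset.add_sum_erase _ _ (show (0 : ℤ) ∈ Icc (-(M : ℤ)) M by simp)]
  congr 1
  -- the fibre `k = 0` is the diagonal
  symm
  refine Finset.sum_nbij' (fun m => (m, m)) (fun p => p.1) ?_ ?_ ?_ ?_ ?_
  · intro m hm
    exact Finset.mem_filter.2 ⟨Finset.mk_mem_product hm hm, by simp⟩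
  · intro p hp
    exact (Finset.mem_product.1 (Finset.mem_filter.1 hp).1).1
  · intro m _
    rfl
  · intro p hp
    have h := (Finset.mem_filter.1 hp).2
    rw [zero_mul, sub_eq_zero, Nat.cast_inj] at h
    exact Prod.ext rfl h
  · intro m _
    rfl

/-- **Item stmt-Parity-13320 (`DivisorSwitch`), proved.** The δ-method as an exact elementary
identity (divisor switching with sharp weights): for every `f : ℕ → ℕ → ℝ` and all `M Q : ℕ`,
`|J| · ∑_{m ∈ (M,2M]} f(m,m) + ∑_{0<|k|≤M} ∑_{j∈J} ∑_{m−m′=kj} f(m,m′) = ∑_{j∈J} ∑_{m≡m′ (mod j)} f(m,m′)`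
with `J = [Q, 2Q)` and pairs in `(M, 2M]²`. Proof: apply
`sum_filter_modEq_eq_diag_add_sum_lines` to each `j ∈ J` (where `j ≥ Q ≥ 1`), sum over `j`, and
exchange the `j`- and `k`-sums. -/
theorem DivisorSwitch_proof :
    Summit.Parity.GeneralizedHardyLittlewood.Theses.LiouvilleMAD.DivisorSwitch := by
  unfold Summit.Parity.GeneralizedHardyLittlewood.Theses.LiouvilleMAD.DivisorSwitch
  intro f M Q
  have key : ∀ j ∈ Ico Q (2 * Q),
      ∑ p ∈ (Ioc M (2 * M) ×ˢ Ioc M (2 * M)).filter (fun p : ℕ × ℕ => p.1 ≡ p.2 [MOD j]), f p.1 p.2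
        = (∑ m ∈ Ioc M (2 * M), f m m)
          + ∑ k ∈ (Icc (-(M : ℤ)) M).erase 0,
              ∑ p ∈ (Ioc M (2 * M) ×ˢ Ioc M (2 * M)).filter
                (fun p : ℕ × ℕ => (p.1 : ℤ) - p.2 = k * (j : ℤ)), f p.1 p.2 := by
    intro j hj
    rw [Finset.mem_Ico] at hj
    exact sum_filter_modEq_eq_diag_add_sum_lines f M (by omega)
  rw [Finset.sum_congr rfl key, Finset.sum_add_distrib, Finset.sum_const, nsmul_eq_mul,
    Finset.sum_comm]

end Summit.Parity.GeneralizedHardyLittlewood.Theorems
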